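import Summits.AtomisticToContinuum.HydrodynamicLimit.Theses.InformationPercolationEngine

/-!
# Sketch — crux-ideate `stmt-AtomisticToContinuum-15177` (`KickFairRelEquilibriumMeso`), round 1, ideator k = 2

Card `flat-start-linear-response` (planner-cruxidea-stmt-AtomisticToContinuum-15177-2-0, 2026-08-16).

LEVER. Condition the local Gibbs law `LG` on COARSE TIME-ZERO DATA `g₀` (the decl's own position cells
`Torus.coarseCell (rs N)` for every sphere + velocity boxes of side `rv N`): exactly
`LG = G.tilted U` with `U z = ∑ᵢ log (f(zᵢ)/f_ref(zᵢ))` a ONE-BODY sum (`localGibbsLaw_eq_tilted_ref`), and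
on each box `A` the conditional tilt `U|_A` varies only through sub-cell offsets and sub-box velocities, so
`Var_(G|A, θ-tilted) U = O((N+1)·((rs N)² + (rv N)²))` — SUB-EXTENSIVE. The exponential-family identity
`d/dθ ∫ Y d(μ.tilted θU) = cov[U, Y]` + Cauchy–Schwarz (`tilted_response_bound`, PROVED here, and
`abs_covariance_le_sqrt_variance_mul`, PROVED) then gives
`|E_(LG|A)|S_h| − E_(G|A)|S_h|| ≤ √((N+1)((rs N)²+(rv N)²)) · sup_θ √Var_θ(S_h)`: the non-equilibrium
sub-cell tilt is removed by LINEAR RESPONSE as soon as the compensated kick sum concentrates at rate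
`o(1/((N+1)((rs N)²+(rv N)²)))` (`TiltPathVarianceAt`), leaving the QUENCHED flat-start statement
`QuenchedFlatStartFairnessAt` (the crux under `G` conditioned on an explicit positive-measure box of initial
data, profile-free) and the shared collision-count uniform integrability `CollisionCountUI`.
`ReductionShape` records the intended composition as a `Prop` (no skeleton at this stage).

All crux-vocabulary `Prop`s reuse the decl's `let`-chain VERBATIM (copied from the ledger signature of
stmt-AtomisticToContinuum-15177) and change only the prefix/tail. Only `localGibbsLaw_eq_tilted_ref` (tree-level unfolding of `canonicalDensity`) is left `sorry` (ideation stage).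
-/

namespace Summit.AtomisticToContinuum.HydrodynamicLimit.Cruxes.KickFairRelEquilibriumMeso.FlatStartResponse

open scoped BigOperators Topology ENNReal Classical
open MeasureTheory ProbabilityTheory Filter Set Metric

/-! ## Abstract lemmas (Mathlib level) -/

/-- Bounded measurable functions are integrable against a finite measure. [folklore] -/
theorem integrable_of_abs_le {Ω : Type*} [MeasurableSpace Ω] (μ : Measure Ω) [IsFiniteMeasure μ] {W : Ω → ℝ} (hW : Measurable W)
    {C : ℝ} (hC : ∀ ω, |W ω| ≤ C) : Integrable W μ :=
  (integrable_const C).mono' hW.aestronglyMeasurable (ae_of_all _ fun ω => by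
    simpa [Real.norm_eq_abs] using hC ω)

/-- Parametric derivative of `θ ↦ ∫ W · exp(θ U)` for bounded measurable `W, U` (dominated
differentiation under the integral sign). [folklore] -/
theorem hasDerivAt_integral_mul_exp {Ω : Type*} [MeasurableSpace Ω] (μ : Measure Ω) [IsFiniteMeasure μ] {U W : Ω → ℝ}
    (hU : Measurable U) (hW : Measurable W) {K L : ℝ} (hK : ∀ ω, |U ω| ≤ K) (hL : ∀ ω, |W ω| ≤ L)
    (θ₀ : ℝ) :
    HasDerivAt (fun θ : ℝ => ∫ ω, W ω * Real.exp (θ * U ω) ∂μ)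
      (∫ ω, W ω * (U ω * Real.exp (θ₀ * U ω)) ∂μ) θ₀ := by
  set K' := max K 0 with hK'
  set L' := max L 0 with hL'
  have hK'0 : 0 ≤ K' := le_max_right _ _
  have hL'0 : 0 ≤ L' := le_max_right _ _
  have hKω : ∀ ω, |U ω| ≤ K' := fun ω => (hK ω).trans (le_max_left _ _)
  have hLω : ∀ ω, |W ω| ≤ L' := fun ω => (hL ω).trans (le_max_left _ _)
  -- the exponential factor is bounded on the ball of radius 1 around θ₀
  have hexp_le : ∀ θ ∈ ball θ₀ 1, ∀ ω, Real.exp (θ * U ω) ≤ Real.exp ((|θ₀| + 1) * K') := by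
    intro θ hθ ω
    have hθ' : |θ - θ₀| < 1 := by simpa [Real.dist_eq] using mem_ball.1 hθ
    have hθabs : |θ| ≤ |θ₀| + 1 := by
      calc |θ| = |θ₀ + (θ - θ₀)| := by ring_nf
        _ ≤ |θ₀| + |θ - θ₀| := abs_add_le _ _
        _ ≤ |θ₀| + 1 := by linarith
    refine Real.exp_le_exp.2 ?_
    calc θ * U ω ≤ |θ * U ω| := le_abs_self _
      _ = |θ| * |U ω| := abs_mul _ _
      _ ≤ (|θ₀| + 1) * K' := mul_le_mul hθabs (hKω ω) (abs_nonneg _) (by positivity)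
  have hmeasF : ∀ θ : ℝ, Measurable fun ω => W ω * Real.exp (θ * U ω) := fun θ =>
    hW.mul ((measurable_const.mul hU).exp)
  have hmeasF' : ∀ θ : ℝ, Measurable fun ω => W ω * (U ω * Real.exp (θ * U ω)) := fun θ =>
    hW.mul (hU.mul ((measurable_const.mul hU).exp))
  refine (hasDerivAt_integral_of_dominated_loc_of_deriv_le (μ := μ) (ball_mem_nhds θ₀ one_pos)
    (F := fun θ ω => W ω * Real.exp (θ * U ω))
    (F' := fun θ ω => W ω * (U ω * Real.exp (θ * U ω)))
    (bound := fun _ => L' * (K' * Real.exp ((|θ₀| + 1) * K')))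
    (Eventually.of_forall fun θ => (hmeasF θ).aestronglyMeasurable) ?_
    (hmeasF' θ₀).aestronglyMeasurable ?_ (integrable_const _) ?_).2
  · -- integrability at θ₀
    refine integrable_of_abs_le μ (hmeasF θ₀) (C := L' * Real.exp ((|θ₀| + 1) * K')) fun ω => ?_
    rw [abs_mul, abs_of_pos (Real.exp_pos _)]
    exact mul_le_mul (hLω ω) (hexp_le θ₀ (mem_ball_self one_pos) ω) (Real.exp_pos _).le hL'0
  · -- uniform bound on the derivative
    refine ae_of_all _ fun ω θ hθ => ?_
    rw [Real.norm_eq_abs, abs_mul, abs_mul, abs_of_pos (Real.exp_pos _)]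
    exact mul_le_mul (hLω ω) (mul_le_mul (hKω ω) (hexp_le θ hθ ω) (Real.exp_pos _).le hK'0)
      (by positivity) hL'0
  · -- pointwise differentiability
    refine ae_of_all _ fun ω θ _ => ?_
    have h := (((hasDerivAt_id θ).mul_const (U ω)).exp).const_mul (W ω)
    refine h.congr_deriv ?_
    simp only [id]
    ring

/-- **Linear response along a tilt path (PROVED).** If along the exponential family
`μ_θ = μ.tilted (θ·U)`, `θ ∈ [0,1]`, the covariance of the tilt exponent `U` with an observable `Y` is
bounded by `B`, then the tilted and untilted means of `Y` differ by at most `B`: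
`|∫ Y d(μ.tilted U) − ∫ Y dμ| ≤ B` (parametric derivative of `θ ↦ ∫ Y dμ_θ` = `cov[U, Y; μ_θ]`, then the
mean value theorem on `[0,1]`). With `abs_covariance_le_sqrt_variance_mul` this is the card's transfer
inequality `|E_(LG|A) Y − E_(G|A) Y| ≤ sup_θ √Var_θ U · √Var_θ Y`. [folklore] -/
theorem tilted_response_bound {Ω : Type*} [MeasurableSpace Ω] (μ : Measure Ω) [IsProbabilityMeasure μ]
    {U Y : Ω → ℝ} (hU : Measurable U) (hUb : ∃ C, ∀ ω, |U ω| ≤ C) (hY : Measurable Y)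
    (hYb : ∃ C, ∀ ω, |Y ω| ≤ C) {B : ℝ}
    (hcov : ∀ θ ∈ Set.Icc (0 : ℝ) 1, |cov[U, Y; μ.tilted (fun ω => θ * U ω)]| ≤ B) :
    |∫ ω, Y ω ∂(μ.tilted U) - ∫ ω, Y ω ∂μ| ≤ B := by
  obtain ⟨K, hK⟩ := hUb
  obtain ⟨L, hL⟩ := hYb
  set Z : ℝ → ℝ := fun θ => ∫ ω, Real.exp (θ * U ω) ∂μ with hZ
  set NY : ℝ → ℝ := fun θ => ∫ ω, Y ω * Real.exp (θ * U ω) ∂μ with hNY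
  set NU : ℝ → ℝ := fun θ => ∫ ω, U ω * Real.exp (θ * U ω) ∂μ with hNU
  set NUY : ℝ → ℝ := fun θ => ∫ ω, (U ω * Y ω) * Real.exp (θ * U ω) ∂μ with hNUY
  set E : ℝ → ℝ := fun θ => NY θ / Z θ with hE
  -- integrability of exp(θ U)
  have hexp_int : ∀ θ : ℝ, Integrable (fun ω => Real.exp (θ * U ω)) μ := fun θ =>
    integrable_of_abs_le μ ((measurable_const.mul hU).exp) (C := Real.exp (|θ| * max K 0)) fun ω => by
      rw [abs_of_pos (Real.exp_pos _)]
      refine Real.exp_le_exp.2 ?_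
      calc θ * U ω ≤ |θ * U ω| := le_abs_self _
        _ = |θ| * |U ω| := abs_mul _ _
        _ ≤ |θ| * max K 0 :=
            mul_le_mul_of_nonneg_left ((hK ω).trans (le_max_left _ _)) (abs_nonneg _)
  have hZpos : ∀ θ, 0 < Z θ := fun θ => integral_exp_pos (hexp_int θ)
  have hprob : ∀ θ : ℝ, IsProbabilityMeasure (μ.tilted fun ω => θ * U ω) := fun θ =>
    isProbabilityMeasure_tilted (hexp_int θ)
  -- tilted integrals of bounded functions
  have htilt : ∀ θ : ℝ, ∀ W : Ω → ℝ,
      ∫ ω, W ω ∂(μ.tilted fun ω => θ * U ω) = (∫ ω, W ω * Real.exp (θ * U ω) ∂μ) / Z θ := by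
    intro θ W
    rw [integral_tilted]
    have : ∀ ω, (Real.exp (θ * U ω) / ∫ x, Real.exp (θ * U x) ∂μ) • W ω
        = (W ω * Real.exp (θ * U ω)) / Z θ := fun ω => by
      rw [smul_eq_mul]; ring
    simp_rw [this]
    exact integral_div _ _
  -- derivatives
  have hZ' : ∀ θ, HasDerivAt Z (NU θ) θ := fun θ => by
    have h := hasDerivAt_integral_mul_exp μ hU measurable_const hK (L := 1) (W := fun _ => (1 : ℝ))
      (fun ω => by simp) θ
    simp only [one_mul] at h
    exact h
  have hNY' : ∀ θ, HasDerivAt NY (NUY θ) θ := fun θ => by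
    have h := hasDerivAt_integral_mul_exp μ hU hY hK hL θ
    refine h.congr_deriv (integral_congr_ae (ae_of_all _ fun ω => ?_))
    ring
  have hE' : ∀ θ, HasDerivAt E ((NUY θ * Z θ - NY θ * NU θ) / Z θ ^ 2) θ := fun θ =>
    (hNY' θ).div (hZ' θ) (hZpos θ).ne'
  -- identify the derivative with the covariance
  have hcovE : ∀ θ, cov[U, Y; μ.tilted fun ω => θ * U ω]
      = (NUY θ * Z θ - NY θ * NU θ) / Z θ ^ 2 := by
    intro θ
    haveI := hprob θ
    have hUm : MemLp U 2 (μ.tilted fun ω => θ * U ω) :=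
      MemLp.of_bound hU.aestronglyMeasurable K
        (ae_of_all _ fun ω => by simpa [Real.norm_eq_abs] using hK ω)
    have hYm : MemLp Y 2 (μ.tilted fun ω => θ * U ω) :=
      MemLp.of_bound hY.aestronglyMeasurable L
        (ae_of_all _ fun ω => by simpa [Real.norm_eq_abs] using hL ω)
    rw [covariance_eq_sub hUm hYm]
    have h1 : ∫ ω, (U * Y) ω ∂(μ.tilted fun ω => θ * U ω) = NUY θ / Z θ := by
      rw [htilt θ (U * Y)]
      rfl
    have h2 : ∫ ω, U ω ∂(μ.tilted fun ω => θ * U ω) = NU θ / Z θ := htilt θ U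
    have h3 : ∫ ω, Y ω ∂(μ.tilted fun ω => θ * U ω) = NY θ / Z θ := htilt θ Y
    rw [h1, h2, h3]
    field_simp [(hZpos θ).ne']
  -- mean value theorem on [0, 1]
  have hMVT : ‖E 1 - E 0‖ ≤ B :=
    norm_image_sub_le_of_norm_deriv_le_segment_01'
      (fun θ _ => (hE' θ).hasDerivWithinAt)
      (fun θ hθ => by
        rw [← hcovE θ, Real.norm_eq_abs]
        exact hcov θ (Ico_subset_Icc_self hθ))
  -- endpoints
  have hE1 : E 1 = ∫ ω, Y ω ∂(μ.tilted U) := by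
    have h := htilt 1 Y
    have hfun : (fun ω => (1 : ℝ) * U ω) = U := by funext ω; simp
    rw [hfun] at h
    rw [h]
  have hE0 : E 0 = ∫ ω, Y ω ∂μ := by
    have h := htilt 0 Y
    have hfun : (fun ω => (0 : ℝ) * U ω) = fun _ => (0 : ℝ) := by funext ω; simp
    rw [hfun, tilted_const] at h
    rw [h]
  rw [← hE1, ← hE0, ← Real.norm_eq_abs]
  exact hMVT

/-- **Cauchy–Schwarz for the covariance.** [folklore] -/
theorem abs_covariance_le_sqrt_variance_mul {Ω : Type*} [MeasurableSpace Ω] (μ : Measure Ω)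
    [IsProbabilityMeasure μ] {U Y : Ω → ℝ} (hU : MemLp U 2 μ) (hY : MemLp Y 2 μ) :
    |cov[U, Y; μ]| ≤ Real.sqrt (variance U μ) * Real.sqrt (variance Y μ) := by
  set a : Ω → ℝ := fun ω => U ω - μ[U] with ha_def
  set b : Ω → ℝ := fun ω => Y ω - μ[Y] with hb_def
  have ha : MemLp a 2 μ := hU.sub (memLp_const _)
  have hb : MemLp b 2 μ := hY.sub (memLp_const _)
  have h1 : |cov[U, Y; μ]| ≤ ∫ ω, ‖a ω‖ * ‖b ω‖ ∂μ := by
    have : cov[U, Y; μ] = ∫ ω, a ω * b ω ∂μ := rfl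
    rw [this, ← Real.norm_eq_abs]
    refine (norm_integral_le_integral_norm _).trans_eq ?_
    simp_rw [norm_mul]
  have ha' : MemLp a (ENNReal.ofReal 2) μ := by simpa using ha
  have hb' : MemLp b (ENNReal.ofReal 2) μ := by simpa using hb
  have h2 := integral_mul_norm_le_Lp_mul_Lq (μ := μ) Real.HolderConjugate.two_two ha' hb'
  have hva : (∫ ω, ‖a ω‖ ^ (2 : ℝ) ∂μ) = variance U μ := by
    rw [variance_eq_integral hU.aemeasurable]
    refine integral_congr_ae (ae_of_all _ fun ω => ?_)
    simp only [Real.norm_eq_abs, Real.rpow_two, sq_abs, ha_def]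
  have hvb : (∫ ω, ‖b ω‖ ^ (2 : ℝ) ∂μ) = variance Y μ := by
    rw [variance_eq_integral hY.aemeasurable]
    refine integral_congr_ae (ae_of_all _ fun ω => ?_)
    simp only [Real.norm_eq_abs, Real.rpow_two, sq_abs, hb_def]
  rw [hva, hvb] at h2
  rw [Real.sqrt_eq_rpow, Real.sqrt_eq_rpow]
  exact h1.trans h2

/-! ## The exact factorisation of the local Gibbs tilt (tree vocabulary) -/

/-- **The local Gibbs law is an exact ONE-BODY exponential tilt of the invariant reference law**:
`LG_(a₀,u₀,θ₀) = G.tilted (∑ᵢ log (f(zᵢ)/f_ref(zᵢ)))`, `G = localGibbsLaw σ 1 0 1`, `f = localGibbsProfile`.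
(Both are `Z⁻¹ 𝟙_D ∏ᵢ f(zᵢ)` against Lebesgue; the hard-core indicator and the normalisations cancel in
`Measure.tilted`.) Conditioned on the decl's time-zero coarse data this tilt is a gentle per-particle
product — the card's starting point. [folklore] -/
theorem localGibbsLaw_eq_tilted_ref (σ : ℝ) (hσ : 0 < σ) (hσ' : σ ≤ 1 / 2)
    (a₀ θ₀ : Literature.MathematicalPhysics.KineticTheory.T3 → ℝ) (u₀ : Literature.MathematicalPhysics.KineticTheory.T3 → Literature.MathematicalPhysics.KineticTheory.V3) (ha : Continuous a₀) (hθ : Continuous θ₀) (hu : Continuous u₀)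
    (ha' : ∀ x, 0 < a₀ x) (hθ' : ∀ x, 0 < θ₀ x) (N : ℕ)
    (Φ : Literature.Analysis.FluidPDE.HardSphereFlow (Literature.Analysis.FluidPDE.Torus.geometry (Fin 3)) (Literature.MathematicalPhysics.KineticTheory.hsDiameter σ N) (N + 1)) :
    Literature.MathematicalPhysics.KineticTheory.localGibbsLaw σ a₀ u₀ θ₀ N Φ =
      (Literature.MathematicalPhysics.KineticTheory.localGibbsLaw σ (fun _ => 1) (fun _ => 0) (fun _ => 1) N Φ).tilted
        (fun z => ∑ i : Fin (N + 1), Real.log (Literature.MathematicalPhysics.KineticTheory.localGibbsProfile a₀ u₀ θ₀ (z i) /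
          Literature.MathematicalPhysics.KineticTheory.localGibbsProfile (fun _ => 1) (fun _ => 0) (fun _ => 1) (z i))) := by
  sorry

/-! ## Typed targets over the crux's vocabulary -/

/-- **Transfer target (A) `QuenchedFlatStartFairnessAt rs rv`** (PROFILE-FREE): with the decl's
`let`-chain verbatim (so `S` is the decl's compensated kick sum with the decl's `κ = condExp` under `G` and
the decl's cells `q = Torus.coarseCell (rs N)`), then the invariant law `Gm`, the time-zero BOX map
`boxOf z = (cells of all positions, integer velocity boxes of side rv N)` and the good set (fourth velocity
moments ≤ `Cb (N+1)`, at most `Cb (N+1)(rs N)³` spheres per cell): for EVERY box label `α`, the compensated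
kick sum is `δ`-small in `L¹` under `Gm` RESTRICTED TO THE BOX (∩ good) — the crux for the flat-start laws
`Gm(·|A)`, quenched in the coarse initial datum. Its non-equilibrium content is "the coarse initial state is
forgotten by the kicks given their own coarse present" (two-time conditional merging under `G`, extended to
`G`-atypical boxes); for kicks whose two flights start at time `0` the merging discrepancy is EXACTLY zero.
[conjecture: this seat] -/
def QuenchedFlatStartFairnessAt (rs rv : ℕ → ℝ) : Prop :=
  ∃ σ₀ : ℝ, 0 < σ₀ ∧ ∀ σ : ℝ, 0 < σ → σ < σ₀ → ∀ Φ : (N : ℕ) → Literature.Analysis.FluidPDE.HardSphereFlow (Literature.Analysis.FluidPDE.Torus.geometry (Fin 3)) (Literature.MathematicalPhysics.KineticTheory.hsDiameter σ N) (N + 1), ∀ τ : ℝ, 0 < τ → ∀ g : Literature.MathematicalPhysics.KineticTheory.V3 × Literature.MathematicalPhysics.KineticTheory.V3 × Literature.MathematicalPhysics.KineticTheory.V3 → ℝ, Continuous g → (∃ C : ℝ, ∀ p, |g p| ≤ C) → ∀ Cb : ℝ, 0 < Cb → ∀ δ : ℝ, 0 < δ → ∃ N₀ : ℕ, ∀ N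 : ℕ, N₀ ≤ N → ∀ h : Fin (N + 1) → ℕ → (((Fin (N + 1) → (Fin 3 → ℤ) × Literature.MathematicalPhysics.KineticTheory.V3) × (Fin (N + 1) → (Fin 3 → ℤ) × Literature.MathematicalPhysics.KineticTheory.V3)) × Fin (N + 1)) × (ℝ × ℝ × ℝ) → ℝ, (∀ i n, Measurable (h i n)) → (∀ i n p, |h i n p| ≤ 1) → let ε := Literature.MathematicalPhysics.KineticTheory.hsDiameter σ N; let G : Literature.Analysis.FluidPDE.Geometry (Fin 3) Literature.MathematicalPhysics.KineticTheory.T3 := Literature.Analysis.FluidPDE.Torus.geometry (Fin 3); let q : Literature.MathematicalPhysics.KineticTheory.T3 → (Fin 3 → ℤ) := Literature.Analysis.FluidPDE.Torus.coarseCell (rs N); let γ : Literature.Analysis.FluidPDE.Config (N + 1) (Fin 3) Literature.MathematicalPhysics.KineticTheory.T3 → ℝ → Literature.Analysis.FluidPDE.Config (N + 1) (Fin 3) Literature.MathematicalPhysics.KineticTheory.T3 := fun z s => (Φ N).flow s z; let cnt : Literature.Analysis.FluidPDE.Config (N + 1) (Fin 3) Literature.MathematicalPhysics.KineticTheory.T3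 → Fin (N + 1) → ℕ := fun z i => Set.ncard (Literature.Analysis.FluidPDE.collisionTimesOf G ε (γ z) i ∩ Set.Ioc 0 τ); let P : Literature.Analysis.FluidPDE.Config (N + 1) (Fin 3) Literature.MathematicalPhysics.KineticTheory.T3 → Fin (N + 1) → ℕ → (((Fin (N + 1) → (Fin 3 → ℤ) × Literature.MathematicalPhysics.KineticTheory.V3) × (Fin (N + 1) → (Fin 3 → ℤ) × Literature.MathematicalPhysics.KineticTheory.V3)) × Fin (N + 1)) × (ℝ × ℝ × ℝ) := fun z i n => if z ∈ (Φ N).good then (((Φ N).coarsePastOf q i n z, (Φ N).nthPartnerOf i n z), (Literature.Analysis.FluidPDE.flightStart G ε (γ z) 0 i ((Φ N).nthCollisionTimeOf i n z), Literature.Analysis.FluidPDE.flightStart G ε (γ z) 0 ((Φ N).nthPartnerOf i n z) ((Φ N).nthCollisionTimeOf i n z), (Φ N).nthCollisionTimeOf i n z)) else (((fun _ => (0, 0), fun _ => (0, 0)), 0), (0, 0, 0)); let X : Fin (N + 1) → ℕ → Literature.Analysis.FluidPDE.Config (N + 1) (Fin 3) Literature.MathematicalPhysics.KineticTheory.T3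 → Literature.MathematicalPhysics.KineticTheory.V3 × Literature.MathematicalPhysics.KineticTheory.V3 × Literature.MathematicalPhysics.KineticTheory.V3 := fun i n z => if z ∈ (Φ N).good then (((Φ N).nthRecordOf i n z).impactVec, ((Φ N).nthRecordOf i n z).preVel) else 0; let κ : Fin (N + 1) → ℕ → Literature.Analysis.FluidPDE.Config (N + 1) (Fin 3) Literature.MathematicalPhysics.KineticTheory.T3 → ℝ := fun i n => MeasureTheory.condExp (MeasurableSpace.comap (fun z => P z i n) inferInstance) (Literature.MathematicalPhysics.KineticTheory.localGibbsLaw σ (fun _ => 1) (fun _ => 0) (fun _ => 1) N (Φ N)) (fun z => g (X i n z)); let S : Literature.Analysis.FluidPDE.Config (N + 1) (Fin 3) Literature.MathematicalPhysics.KineticTheory.T3 → ℝ := fun z => ε / (N + 1 : ℝ) * ∑ i : Fin (N + 1), ∑ n ∈ Finset.range (cnt z i), h i n (P z i n) * (g (X i n z) - κ i n z); let Gm : MeasureTheory.Measure (Literature.Analysis.FluidPDE.Config (N + 1) (Fin 3) Literature.MathematicalPhysics.KineticTheory.T3) := Literature.MathematicalPhysics.KineticTheory.localGibbsLaw σ (fun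 _ => 1) (fun _ => 0) (fun _ => 1) N (Φ N); let boxOf : Literature.Analysis.FluidPDE.Config (N + 1) (Fin 3) Literature.MathematicalPhysics.KineticTheory.T3 → (Fin (N + 1) → (Fin 3 → ℤ) × (Fin 3 → ℤ)) := fun z i => (q (z i).1, fun k : Fin 3 => ⌊(z i).2 k / rv N⌋); let good : Set (Literature.Analysis.FluidPDE.Config (N + 1) (Fin 3) Literature.MathematicalPhysics.KineticTheory.T3) := {z | (∑ i : Fin (N + 1), ‖(z i).2‖ ^ 4 ≤ Cb * ((N : ℝ) + 1)) ∧ ∀ c : Fin 3 → ℤ, ((Finset.univ.filter (fun i : Fin (N + 1) => q (z i).1 = c)).card : ℝ) ≤ Cb * (((N : ℝ) + 1) * rs N ^ 3)}; ∀ α : Fin (N + 1) → (Fin 3 → ℤ) × (Fin 3 → ℤ), let A : Set (Literature.Analysis.FluidPDE.Config (N + 1) (Fin 3) Literature.MathematicalPhysics.KineticTheory.T3) := {z | boxOf z = α} ∩ good; ∫⁻ z in A, ENNReal.ofReal |S z| ∂Gm ≤ ENNReal.ofReal δ * Gm A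

/-- **Transfer target (B) `TiltPathVarianceAt rs rv`**: for continuous positive profiles, along the
conditional tilt path `θ ∈ [0,1]` on every box, the compensated kick sum, clamped at any level `M` (no junk escape through
non-square-integrability; `Var` of a `1`-Lipschitz image is at most `Var`), has variance
`o(1/((N+1)((rs N)² + (rv N)²)))` under `(Gm|A).tilted (θU)`, `U = ∑ᵢ log(f(zᵢ)/f_ref(zᵢ))` the EXACT
log-density of `LG` w.r.t. `Gm` (`localGibbsLaw_eq_tilted_ref`), uniformly in `θ`, in the box and in the
admissible weights — a SECOND-MOMENT concentration statement at a weak polynomial rate (network value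
`Var ≍ N^(-4/3)` against the threshold `N^(-1/3)·(ε/r₀)²`; the particle diagonal `A/(N+1)` of the Hoeffding
split is below threshold for free, only stranger covariances must decay). [conjecture: this seat] -/
def TiltPathVarianceAt (rs rv : ℕ → ℝ) : Prop :=
  ∀ (a₀ θ₀ : Literature.MathematicalPhysics.KineticTheory.T3 → ℝ) (u₀ : Literature.MathematicalPhysics.KineticTheory.T3 → Literature.MathematicalPhysics.KineticTheory.V3), Continuous a₀ → Continuous θ₀ → Continuous u₀ → (∀ x, 0 < a₀ x) → (∀ x, 0 < θ₀ x) → ∃ σ₀ : ℝ, 0 < σ₀ ∧ ∀ σ : ℝ, 0 < σ → σ < σ₀ → ∀ Φ : (N : ℕ) → Literature.Analysis.FluidPDE.HardSphereFlow (Literature.Analysis.FluidPDE.Torus.geometry (Fin 3)) (Literature.MathematicalPhysics.KineticTheory.hsDiameter σ N) (N + 1), ∀ τ : ℝ, 0 < τ → ∀ g : Literature.MathematicalPhysics.KineticTheory.V3 × Literature.MathematicalPhysics.KineticTheory.V3 × Literature.MathematicalPhysics.KineticTheory.V3 → ℝ, Continuous g → (∃ C : ℝ, ∀ p, |g p| ≤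 C) → ∀ Cb : ℝ, 0 < Cb → ∀ δ : ℝ, 0 < δ → ∃ N₀ : ℕ, ∀ N : ℕ, N₀ ≤ N → ∀ h : Fin (N + 1) → ℕ → (((Fin (N + 1) → (Fin 3 → ℤ) × Literature.MathematicalPhysics.KineticTheory.V3) × (Fin (N + 1) → (Fin 3 → ℤ) × Literature.MathematicalPhysics.KineticTheory.V3)) × Fin (N + 1)) × (ℝ × ℝ × ℝ) → ℝ, (∀ i n, Measurable (h i n)) → (∀ i n p, |h i n p| ≤ 1) → let ε := Literature.MathematicalPhysics.KineticTheory.hsDiameter σ N; let G : Literature.Analysis.FluidPDE.Geometry (Fin 3) Literature.MathematicalPhysics.KineticTheory.T3 := Literature.Analysis.FluidPDE.Torus.geometry (Fin 3); let q : Literature.MathematicalPhysics.KineticTheory.T3 → (Fin 3 → ℤ) := Literature.Analysis.FluidPDE.Torus.coarseCell (rs N); let γ : Literature.Analysis.FluidPDE.Config (N + 1) (Fin 3) Literature.MathematicalPhysics.KineticTheory.T3 → ℝ → Literature.Analysis.FluidPDE.Config (N + 1) (Fin 3) Literature.MathematicalPhysics.KineticTheory.T3 := fun z s => (Φ N).flow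 s z; let cnt : Literature.Analysis.FluidPDE.Config (N + 1) (Fin 3) Literature.MathematicalPhysics.KineticTheory.T3 → Fin (N + 1) → ℕ := fun z i => Set.ncard (Literature.Analysis.FluidPDE.collisionTimesOf G ε (γ z) i ∩ Set.Ioc 0 τ); let P : Literature.Analysis.FluidPDE.Config (N + 1) (Fin 3) Literature.MathematicalPhysics.KineticTheory.T3 → Fin (N + 1) → ℕ → (((Fin (N + 1) → (Fin 3 → ℤ) × Literature.MathematicalPhysics.KineticTheory.V3) × (Fin (N + 1) → (Fin 3 → ℤ) × Literature.MathematicalPhysics.KineticTheory.V3)) × Fin (N + 1)) × (ℝ × ℝ × ℝ) := fun z i n => if z ∈ (Φ N).good then (((Φ N).coarsePastOf q i n z, (Φ N).nthPartnerOf i n z), (Literature.Analysis.FluidPDE.flightStart G ε (γ z) 0 i ((Φ N).nthCollisionTimeOf i n z), Literature.Analysis.FluidPDE.flightStart G ε (γ z) 0 ((Φ N).nthPartnerOf i n z) ((Φ N).nthCollisionTimeOf i n z), (Φ N).nthCollisionTimeOf i n z)) else (((fun _ => (0, 0), fun _ => (0, 0)), 0), (0, 0, 0)); let X : Fin (N +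 1) → ℕ → Literature.Analysis.FluidPDE.Config (N + 1) (Fin 3) Literature.MathematicalPhysics.KineticTheory.T3 → Literature.MathematicalPhysics.KineticTheory.V3 × Literature.MathematicalPhysics.KineticTheory.V3 × Literature.MathematicalPhysics.KineticTheory.V3 := fun i n z => if z ∈ (Φ N).good then (((Φ N).nthRecordOf i n z).impactVec, ((Φ N).nthRecordOf i n z).preVel) else 0; let κ : Fin (N + 1) → ℕ → Literature.Analysis.FluidPDE.Config (N + 1) (Fin 3) Literature.MathematicalPhysics.KineticTheory.T3 → ℝ := fun i n => MeasureTheory.condExp (MeasurableSpace.comap (fun z => P z i n) inferInstance) (Literature.MathematicalPhysics.KineticTheory.localGibbsLaw σ (fun _ => 1) (fun _ => 0) (fun _ => 1) N (Φ N)) (fun z => g (X i n z)); let S : Literature.Analysis.FluidPDE.Config (N + 1) (Fin 3) Literature.MathematicalPhysics.KineticTheory.T3 → ℝ := fun z => ε / (N + 1 : ℝ) * ∑ i : Fin (N + 1), ∑ n ∈ Finset.range (cnt z i), h i n (P z i n) * (g (X i n z) - κ i n z); let Gm : MeasureTheory.Measure (Literature.Analysis.FluidPDE.Config (N + 1) (Fin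 3) Literature.MathematicalPhysics.KineticTheory.T3) := Literature.MathematicalPhysics.KineticTheory.localGibbsLaw σ (fun _ => 1) (fun _ => 0) (fun _ => 1) N (Φ N); let boxOf : Literature.Analysis.FluidPDE.Config (N + 1) (Fin 3) Literature.MathematicalPhysics.KineticTheory.T3 → (Fin (N + 1) → (Fin 3 → ℤ) × (Fin 3 → ℤ)) := fun z i => (q (z i).1, fun k : Fin 3 => ⌊(z i).2 k / rv N⌋); let good : Set (Literature.Analysis.FluidPDE.Config (N + 1) (Fin 3) Literature.MathematicalPhysics.KineticTheory.T3) := {z | (∑ i : Fin (N + 1), ‖(z i).2‖ ^ 4 ≤ Cb * ((N : ℝ) + 1)) ∧ ∀ c : Fin 3 → ℤ, ((Finset.univ.filter (fun i : Fin (N + 1) => q (z i).1 = c)).card : ℝ) ≤ Cb * (((N : ℝ) + 1) * rs N ^ 3)}; let U : Literature.Analysis.FluidPDE.Config (N + 1) (Fin 3) Literature.MathematicalPhysics.KineticTheory.T3 → ℝ := fun z => ∑ i : Fin (N + 1), Real.log (Literature.MathematicalPhysics.KineticTheory.localGibbsProfile a₀ u₀ θ₀ (z i) / Literature.MathematicalPhysics.KineticTheory.localGibbsProfile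 (fun _ => 1) (fun _ => 0) (fun _ => 1) (z i)); ∀ M : ℝ, 0 < M → ∀ θ : ℝ, θ ∈ Set.Icc (0 : ℝ) 1 → ∀ α : Fin (N + 1) → (Fin 3 → ℤ) × (Fin 3 → ℤ), let A : Set (Literature.Analysis.FluidPDE.Config (N + 1) (Fin 3) Literature.MathematicalPhysics.KineticTheory.T3) := {z | boxOf z = α} ∩ good; ProbabilityTheory.variance (fun z => max (-M) (min M (S z))) ((Gm.restrict A).tilted (fun z => θ * U z)) ≤ δ / (((N : ℝ) + 1) * (rs N ^ 2 + rv N ^ 2))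

/-- **Shared a-priori input `CollisionCountUI`**: uniform integrability, under the local Gibbs law, of the
normalised total collision count `(ε/(N+1)) ∑ᵢ cntᵢ(0,τ]` (which dominates `|S_h|/(2‖g‖∞)`): for every
`η > 0` a level `M` with `E[(ε/(N+1)∑ᵢcntᵢ − M)₊] ≤ η` for all `N`. First-moment sibling of
`only-strangers-matter`'s `TaggedCollisionCountL2`; expected from stationarity + contact-flux bound + the
entropy inequality. [conjecture: shared a-priori input] -/
def CollisionCountUI : Prop :=
  ∀ (a₀ θ₀ : Literature.MathematicalPhysics.KineticTheory.T3 → ℝ) (u₀ : Literature.MathematicalPhysics.KineticTheory.T3 → Literature.MathematicalPhysics.KineticTheory.V3), Continuous a₀ → Continuous θ₀ → Continuous u₀ → (∀ x, 0 < a₀ x) → (∀ x, 0 < θ₀ x) → ∃ σ₀ : ℝ, 0 < σ₀ ∧ ∀ σ : ℝ, 0 < σ → σ < σ₀ → ∀ Φ : (N : ℕ) → Literature.Analysis.FluidPDE.HardSphereFlow (Literature.Analysis.FluidPDE.Torus.geometry (Fin 3)) (Literature.MathematicalPhysics.KineticTheory.hsDiameter σ N) (N + 1), ∀ τ : ℝ,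 0 < τ → ∀ η : ℝ, 0 < η → ∃ M : ℝ, ∀ N : ℕ, let ε := Literature.MathematicalPhysics.KineticTheory.hsDiameter σ N; let G : Literature.Analysis.FluidPDE.Geometry (Fin 3) Literature.MathematicalPhysics.KineticTheory.T3 := Literature.Analysis.FluidPDE.Torus.geometry (Fin 3); let γ : Literature.Analysis.FluidPDE.Config (N + 1) (Fin 3) Literature.MathematicalPhysics.KineticTheory.T3 → ℝ → Literature.Analysis.FluidPDE.Config (N + 1) (Fin 3) Literature.MathematicalPhysics.KineticTheory.T3 := fun z s => (Φ N).flow s z; let cnt : Literature.Analysis.FluidPDE.Config (N + 1) (Fin 3) Literature.MathematicalPhysics.KineticTheory.T3 → Fin (N + 1) → ℕ := fun z i => Set.ncard (Literature.Analysis.FluidPDE.collisionTimesOf G ε (γ z) i ∩ Set.Ioc 0 τ); ∫⁻ z, ENNReal.ofReal (ε / (N + 1 : ℝ) * (∑ i : Fin (N + 1), (cnt z i : ℝ)) - M) ∂(Literature.MathematicalPhysics.KineticTheory.localGibbsLaw σ a₀ u₀ θ₀ N (Φ N)) ≤ ENNReal.ofReal η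

/-- **The intended composition (a `Prop`, NOT a skeleton)**: for admissible `rs` (the decl's window, lower
edge) and any positive velocity resolution `rv`, (A) ∧ (B) ∧ UI ⇒ the crux, by
`localGibbsLaw_eq_tilted_ref` (conditioning on boxes commutes with tilting), `tilted_response_bound` +
`abs_covariance_le_sqrt_variance_mul` on each good box with `Var U|_A ≤ C(N+1)((rs N)²+(rv N)²)`
(Lipschitz one-body sum on a box; hard-core Poincaré at small packing), `Var |S| ≤ Var S`, the `LG`-mass of
bad boxes `→ 0` (Maxwellian moments + LLN density cap, `σ < σ₀`), truncation `|S| ∧ M` and `CollisionCountUI`. -/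
def ReductionShape : Prop :=
  ∀ rs rv : ℕ → ℝ, (∀ N, 0 < rs N) → Filter.Tendsto rs Filter.atTop (nhds 0) → Filter.Tendsto (fun N : ℕ => ((N : ℝ) + 1) * rs N ^ 3) Filter.atTop Filter.atTop → (∀ N, 0 < rv N) → QuenchedFlatStartFairnessAt rs rv → TiltPathVarianceAt rs rv → CollisionCountUI →
    Summit.AtomisticToContinuum.HydrodynamicLimit.Theses.InformationPercolationEngine.KickFairRelEquilibriumMeso

end Summit.AtomisticToContinuum.HydrodynamicLimit.Cruxes.KickFairRelEquilibriumMeso.FlatStartResponse
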